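import Literature.NumberTheory.LFunctions.ChebyshevHalfLineBiasCharExplicitFormula
import Literature.NumberTheory.LFunctions.ChebyshevHalfLineBiasChi4Proofs
import Literature.Analysis.SpecialFunctions.DigammaGauss
import Mathlib.Analysis.SpecialFunctions.Gamma.Digamma
import Mathlib.NumberTheory.LegendreSymbol.ZModChar
import HarnessLib

/-!
# GRH(χ₄)-EQUIVALENT criterion (Suzuki 2025, Thm 3: (i) ⟺ (ii) ⟺ (iii)), PROVED — «nothing here bears on the truth of RH»
# `GRH for L(s, χ₄)` ⟺ `Σ_{n ≤ x} Λ(n)χ₄(n) n^{-1/2} log(x/n) ≤ 0` eventually ⟺ the Riesz limit `= −(L'/L)(½, χ₄)`: discharge of `Suzuki2025Chebyshev_thm3`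

LINE 1 — LABEL: RH-FREE literature (a kernel proof of a GRH(χ₄)-EQUIVALENCE; its clauses (i) ⟹ (ii), (i) ⟹ (iii)
are GRH(χ₄)-CONDITIONAL, (ii) ⟹ (i) and (iii) ⟹ (i) GRH(χ₄)-IMPLYING). bears_on: LADDER-RH COLUMN 1 SCREW (S-C,
criterion rung). WHAT THIS IS NOT: not a route, not progress toward RH or GRH — an equivalence fixes WHICH limit
statements are the GRH for `L(s, χ₄)`, it does not move it; nothing here bears on the truth of RH.

M. Suzuki, *On variants of Chebyshev's conjecture*, Ramanujan J. **68** (2025), no. 4, art. 95 = arXiv:2411.07436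
[`Suzuki2025Chebyshev`; PUBLISHED, refereed], §1.2, **Theorem 3**, AS PRINTED: «The following three statements are
equivalent: (i) The GRH for `L(s, χ₄)` holds. (ii) There exists an `x₀ ≥ 2` such that
`Σ_{n ≤ x} Λ(n)χ₄(n) n^{-1/2} log(x/n) ≤ 0` (1.14) holds for all `x ≥ x₀`. (iii) It holds that
`lim_{x→∞} Σ_{n ≤ x} Λ(n)χ₄(n) n^{-1/2}(1 − log n/log x) = −(L'/L)(1/2, χ₄)` (1.15).» This is the named fact
`Suzuki2025Chebyshev_thm3` of `ChebyshevHalfLineBiasVariants.lean` (RH literature-typing tranche 1, p461476), typed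
as `(i) ⟺ (ii) ∧ (i) ⟺ (iii)` with the tree's open-strip `DirichletCharacter.RiemannHypothesis` and
`−(L'/L)(½, χ₄) = −(logDeriv L(·, χ₄) (1/2)).re`, DISCHARGED here: `Suzuki2025Chebyshev_thm3_holds`. Theorems only:
no definitions, no named facts (D-0014/D-0026).

## The printed proof (§4.1, proof of Thm 3 from Thm 8) and this formalisation

«From the second half of Theorem 8, we see that the first and third claims of Theorem 3 are equivalent. … `L(s, χ₄)`
has no zeros on the positive real line … by the first half of Theorem 8, the second claim implies the first claim.
… since `χ₄` is primitive, the third claim implies the second claim.» Formalised as four implications: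

* **(ii) ⟹ (i)** — the tree's `Suzuki2025Chebyshev_thm3_ii_imp_i` (`ChebyshevHalfLineBiasChi4Proofs.lean`:
  Landau's theorem through `Suzuki2025Chebyshev_thm8_sign_holds`, with Fekete–Pólya for `L(σ, χ₄) ≠ 0`, `σ > 0`).
* **(i) ⟹ (iii)** (`Suzuki2025Chebyshev_thm3_i_imp_iii`) — Thm 8, (4.2) ⟸ GRH, at `χ = χ₄`: the tree's
  `HalfLineRiesz.tendsto_rieszMean_of_GRH` (`ChebyshevHalfLineBiasCharExplicitFormula.lean`: the exact explicit
  formula (4.5) and its boundedness under GRH), fed with `χ₄` PRIMITIVE (`χ4_isPrimitive`: conductor `∤ 2` because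
  `χ₄(3) = −1`) and `L(½, χ₄) ≠ 0` (the tree's `SuzukiChi4.LFunction_χ₄_ne_zero_of_pos`).
* **(i) ⟹ (ii)** (`Suzuki2025Chebyshev_thm3_i_imp_ii`) — under GRH `f_{χ₄}(x) = −(L'/L)(½, χ₄) log x + O(1)`
  (`HalfLineRiesz.exists_norm_halfLineSum_add_le_of_GRH`), and **`(L'/L)(½, χ₄) > 0`**, so `f_{χ₄}(x) ≤ 0` for
  `x ≥ max(2, e^{B/(L'/L)(½,χ₄)})`.
* **(iii) ⟹ (ii)** (`Suzuki2025Chebyshev_thm3_iii_imp_ii`) — the limit `−(L'/L)(½, χ₄)` is negative, and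
  `f_{χ₄}(x) = log x · (Riesz mean)`; hence (iii) ⟹ (ii) ⟹ (i).

The sign `(L'/L)(½, χ₄) > 0` is the paper's (4.6), «`Re(L'/L)(1/2) = ½[log(π/q) − (Γ'/Γ)(¼ + κ/2)]`», at `q = 4`,
`κ = 1`: here `logDeriv_LFunction_χ4_half`, **`(L'/L)(½, χ₄) = −log 2 + ½ log π − ½ ψ(¾)`**, proved from Mathlib's
functional equation `Λ(1−s, χ) = N^{s−½} ε(χ) Λ(s, χ⁻¹)` (`DirichletCharacter.IsPrimitive.completedLFunction_one_sub`)
with `χ₄⁻¹ = χ₄` (quadratic) — at `s = ½` it FORCES `ε(χ₄) = 1` because `Λ(½, χ₄) ≠ 0` (no Gauss sum is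
evaluated), and its `s`-derivative at `½` gives `Λ'/Λ(½, χ₄) = −log 2` (`logDeriv_completedLFunction_χ4_half`) —
together with `L = Λ/γ`, `γ(s, χ₄) = Γ_ℝ(s+1) = π^{−(s+1)/2}Γ((s+1)/2)` (`logDeriv_gammaFactor_χ4_half`:
`γ'/γ(½) = −½ log π + ½ ψ(¾)`, `ψ = Complex.digamma`). Positivity: `ψ(¾) ≤ −γ` (`re_digamma_three_quarters_le`, from
the tree's Andrews–Askey–Roy series `ψ(w) + γ = Σ_k (1/(k+1) − 1/(w+k))`, `hasSum_one_div_sub_one_div_digamma`,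
whose terms are negative at `w = ¾`), so `(L'/L)(½, χ₄) ≥ −log 2 + ½ log π + ½ γ > 0` by `γ > ½`, `log π > 1`,
`log 2 < 0.6931471808` (`re_logDeriv_LFunction_χ4_half_pos`; numerically `(L'/L)(½, χ₄) = 0.4221…` — the value
«0.3031…» quoted in the docstring of `ChebyshevHalfLineBiasVariants.lean` is not used anywhere and is superseded by
this kernel statement; under GRH the sum (1.14) is eventually NEGATIVE, as Thm 3 (ii) says).

## References
* [Suzuki2025Chebyshev] M. Suzuki, Ramanujan J. 68 (2025) 95 = arXiv:2411.07436: §1.2 Thm 3; §4.1 Thm 8, (4.2)–(4.6),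
  proof of Thm 3; §2.3 (2.10)–(2.11).
* [MontgomeryVaughan2007] H. L. Montgomery, R. C. Vaughan, *Multiplicative Number Theory I*, §9.1 (primitive
  characters), Cor. 10.8, §11.2.1 Ex. 7 (Fekete–Pólya).
* [AndrewsAskeyRoy1999] G. E. Andrews, R. Askey, R. Roy, *Special Functions*, Thm 1.2.5 (1.2.13) — the tree's
  `DigammaGauss.lean`.
-/


noncomputable section

open Complex Real Filter Topology ArithmeticFunction

namespace Literature.NumberTheory.LFunctions

namespace SuzukiChi4Riesz

/-! ## §1 The character `χ₄` as a complex Dirichlet character mod 4 -/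

/-- `χ₄(n)` as a complex number is the integer `χ₄(n)`. [folklore] -/
private theorem χ4_apply (n : ℕ) :
    (ZMod.χ₄.ringHomComp (Int.castRingHom ℂ)) (n : ZMod 4) = ((ZMod.χ₄ (n : ZMod 4) : ℤ) : ℂ) := by
  rw [MulChar.ringHomComp_apply]
  simp

/-- `χ₄(3) = −1` in `ℂ`. [folklore] -/
private theorem χ4_three : (ZMod.χ₄.ringHomComp (Int.castRingHom ℂ)) (3 : ZMod 4) = -1 := by
  have hv : ZMod.χ₄ (3 : ZMod 4) = -1 := by decide
  rw [MulChar.ringHomComp_apply, hv]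
  simp

/-- `χ₄ ≠ χ₀`. [folklore] -/
private theorem χ4_ne_one : (ZMod.χ₄.ringHomComp (Int.castRingHom ℂ) : DirichletCharacter ℂ 4) ≠ 1 := by
  intro h
  have h3 := congrArg (fun χ : DirichletCharacter ℂ 4 ↦ χ (3 : ZMod 4)) h
  have hu : IsUnit (3 : ZMod 4) := IsUnit.of_mul_eq_one (3 : ZMod 4) (by decide)
  simp only [χ4_three, MulChar.one_apply hu] at h3
  norm_num at h3

/-- `χ₄` is odd: `χ₄(−1) = −1`. [folklore] -/
private theorem χ4_odd : DirichletCharacter.Odd (ZMod.χ₄.ringHomComp (Int.castRingHom ℂ) : DirichletCharacter ℂ 4) := by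
  rw [DirichletCharacter.Odd, show (-1 : ZMod 4) = 3 by decide, χ4_three]

/-- `χ₄` is quadratic, hence `χ₄⁻¹ = χ₄`. [folklore] -/
private theorem χ4_inv : (ZMod.χ₄.ringHomComp (Int.castRingHom ℂ) : DirichletCharacter ℂ 4)⁻¹ =
    ZMod.χ₄.ringHomComp (Int.castRingHom ℂ) :=
  (ZMod.isQuadratic_χ₄.comp _).inv

/-- **`χ₄` is primitive** (conductor `4`: it is non-trivial, and it does not factor through level `2`
since `χ₄(3) = −1` while `3 ≡ 1 (mod 2)`). [cite: MontgomeryVaughan2007, §9.1] -/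
theorem χ4_isPrimitive : DirichletCharacter.IsPrimitive (ZMod.χ₄.ringHomComp (Int.castRingHom ℂ) : DirichletCharacter ℂ 4) := by
  set χ : DirichletCharacter ℂ 4 := ZMod.χ₄.ringHomComp (Int.castRingHom ℂ) with hχdef
  rw [DirichletCharacter.isPrimitive_def]
  have hdvd : χ.conductor ∣ 4 := DirichletCharacter.conductor_dvd_level χ
  have hne1 : χ.conductor ≠ 1 := fun h ↦
    χ4_ne_one ((DirichletCharacter.eq_one_iff_conductor_eq_one (χ := χ)).2 h)
  have hmem : χ.conductor ∈ Nat.divisors 4 := Nat.mem_divisors.2 ⟨hdvd, by norm_num⟩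
  have hdiv : Nat.divisors 4 = {1, 2, 4} := by decide
  rw [hdiv] at hmem
  simp only [Finset.mem_insert, Finset.mem_singleton] at hmem
  rcases hmem with h | h | h
  · exact absurd h hne1
  · -- conductor 2: χ would factor through level 2, forcing χ(3) = 1
    exfalso
    have hfac : χ.FactorsThrough 2 := by
      have := DirichletCharacter.conductor_mem_conductorSet χ
      rw [h] at this
      exact (DirichletCharacter.mem_conductorSet_iff χ).1 this
    obtain ⟨h2, χ₀, hχ₀⟩ := hfac
    have hu : IsUnit (3 : ZMod 4) := IsUnit.of_mul_eq_one (3 : ZMod 4) (by decide)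
    obtain ⟨u, hu'⟩ := hu
    have h3 : χ (3 : ZMod 4) = -1 := χ4_three
    rw [hχ₀, ← hu', DirichletCharacter.changeLevel_eq_cast_of_dvd χ₀ h2 u, hu'] at h3
    have hcast : (ZMod.cast (3 : ZMod 4) : ZMod 2) = 1 := by decide
    rw [hcast, map_one] at h3
    norm_num at h3
  · exact h

/-- `L(½, χ₄) ≠ 0` (the tree's Fekete–Pólya positivity `SuzukiChi4.LFunction_χ₄_ne_zero_of_pos`).
[cite: MontgomeryVaughan2007, §11.2.1 Exercise 7 (a)–(b)] -/
theorem LFunction_χ4_half_ne_zero :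
    DirichletCharacter.LFunction (ZMod.χ₄.ringHomComp (Int.castRingHom ℂ) : DirichletCharacter ℂ 4) (1 / 2) ≠ 0 := by
  have h := SuzukiChi4.LFunction_χ₄_ne_zero_of_pos (σ := 1 / 2) (by norm_num)
  have hc : ((1 / 2 : ℝ) : ℂ) = 1 / 2 := by push_cast; ring
  rwa [hc] at h

/-! ## §2 The sign of `(L'/L)(½, χ₄)`: `(L'/L)(½, χ₄) = −log 2 + ½ log π − ½ ψ(¾) > 0` -/

/-- **`Λ'(½, χ₄)/Λ(½, χ₄) = −log 2`**: differentiate the functional equation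
`Λ(1 − s, χ₄) = 4^{s − 1/2} ε(χ₄) Λ(s, χ₄)` (Mathlib, `χ₄⁻¹ = χ₄`) at `s = ½`, where `ε(χ₄) = 1` is
FORCED by `Λ(½, χ₄) ≠ 0`. [cite: Suzuki2025Chebyshev, §4.1 (proof of (4.6): «taking the logarithmic derivative of (2.11) and substituting s = 1/2»)] -/
theorem logDeriv_completedLFunction_χ4_half :
    deriv (DirichletCharacter.completedLFunction (ZMod.χ₄.ringHomComp (Int.castRingHom ℂ) : DirichletCharacter ℂ 4)) (1 / 2) /
      DirichletCharacter.completedLFunction (ZMod.χ₄.ringHomComp (Int.castRingHom ℂ) : DirichletCharacter ℂ 4) (1 / 2) =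
      -Real.log 2 := by
  set χ : DirichletCharacter ℂ 4 := ZMod.χ₄.ringHomComp (Int.castRingHom ℂ) with hχdef
  set Lam := χ.completedLFunction with hLam
  have hχ1 : χ ≠ 1 := χ4_ne_one
  have hprim : χ.IsPrimitive := χ4_isPrimitive
  -- `Λ(½) ≠ 0`
  have hG : χ.gammaFactor (1 / 2) ≠ 0 :=
    SiegelZero.gammaFactor_ne_zero_of_re_pos χ (by norm_num)
  have hLamhalf : Lam (1 / 2) ≠ 0 := by
    intro h0
    have hL := DirichletCharacter.LFunction_eq_completed_div_gammaFactor χ (1 / 2) (Or.inr (by norm_num))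
    rw [← hLam, h0, zero_div] at hL
    exact LFunction_χ4_half_ne_zero hL
  -- the functional equation with `χ⁻¹ = χ`
  have hFE : ∀ s : ℂ, Lam (1 - s) = (4 : ℂ) ^ (s - 1 / 2) * χ.rootNumber * Lam s := by
    intro s
    have h := DirichletCharacter.IsPrimitive.completedLFunction_one_sub hprim s
    rw [χ4_inv, ← hχdef] at h
    rw [hLam, h]
    push_cast
    ring
  -- `ε = 1`
  have hε : χ.rootNumber = 1 := by
    have h := hFE (1 / 2)
    norm_num at h
    -- `Λ(1/2) = ε Λ(1/2)`
    have h' : (χ.rootNumber - 1) * Lam (1 / 2) = 0 := by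
      rw [sub_mul, one_mul, sub_eq_zero]; exact h.symm
    rcases mul_eq_zero.1 h' with h1 | h1
    · exact sub_eq_zero.1 h1
    · exact absurd h1 hLamhalf
  -- differentiate both sides at `s = 1/2`
  have hdiff : Differentiable ℂ Lam := DirichletCharacter.differentiable_completedLFunction hχ1
  have h12 : (1 : ℂ) - 1 / 2 = 1 / 2 := by norm_num
  have hL1 : HasDerivAt (fun s : ℂ ↦ Lam (1 - s)) (-deriv Lam (1 / 2)) (1 / 2) := by
    have hd : HasDerivAt Lam (deriv Lam (1 / 2)) (1 - 1 / 2) := by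
      rw [h12]; exact (hdiff _).hasDerivAt
    have h := hd.comp (1 / 2 : ℂ) ((hasDerivAt_id (1 / 2 : ℂ)).const_sub 1)
    refine h.congr_deriv ?_
    ring
  have hR1 : HasDerivAt (fun s : ℂ ↦ (4 : ℂ) ^ (s - 1 / 2) * χ.rootNumber * Lam s)
      ((4 : ℂ) ^ ((1 / 2 : ℂ) - 1 / 2) * Complex.log 4 * 1 * χ.rootNumber * Lam (1 / 2)
        + (4 : ℂ) ^ ((1 / 2 : ℂ) - 1 / 2) * χ.rootNumber * deriv Lam (1 / 2)) (1 / 2) := by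
    have hc : HasDerivAt (fun s : ℂ ↦ (4 : ℂ) ^ (s - 1 / 2)) ((4 : ℂ) ^ ((1 / 2 : ℂ) - 1 / 2) * Complex.log 4 * 1)
        (1 / 2) := ((hasDerivAt_id (1 / 2 : ℂ)).sub_const (1 / 2)).const_cpow (Or.inl (by norm_num))
    exact (hc.mul_const χ.rootNumber).mul (hdiff _).hasDerivAt
  have hfun : (fun s : ℂ ↦ Lam (1 - s)) = fun s : ℂ ↦ (4 : ℂ) ^ (s - 1 / 2) * χ.rootNumber * Lam s :=
    funext hFE
  rw [hfun] at hL1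
  have heq := hL1.unique hR1
  rw [hε, sub_self, Complex.cpow_zero] at heq
  have hlog4 : Complex.log 4 = 2 * (Real.log 2 : ℂ) := by
    rw [show (4 : ℂ) = ((4 : ℝ) : ℂ) by norm_num, ← Complex.ofReal_log (by norm_num),
      show (4 : ℝ) = 2 ^ 2 by norm_num, Real.log_pow]
    push_cast; ring
  rw [hlog4] at heq
  -- `−Λ' = 2 log 2 · Λ + Λ'`
  rw [div_eq_iff hLamhalf]
  linear_combination (-1 / 2 : ℂ) * heq

/-- `γ(s, χ₄) = π^{−(s+1)/2} Γ((s+1)/2)` (odd character). [folklore] -/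
private theorem gammaFactor_χ4_eq :
    DirichletCharacter.gammaFactor (ZMod.χ₄.ringHomComp (Int.castRingHom ℂ) : DirichletCharacter ℂ 4) =
      fun s : ℂ ↦ (π : ℂ) ^ (-(s + 1) / 2) * Complex.Gamma ((s + 1) / 2) := by
  funext s
  rw [χ4_odd.gammaFactor_def, Complex.Gammaℝ_def]

/-- `¾` is not a pole of `Γ`. [folklore] -/
private theorem three_quarters_ne_neg_nat (m : ℕ) : (3 / 4 : ℂ) ≠ -m := by
  intro h
  have := congrArg Complex.re h
  simp at this
  have : (0 : ℝ) ≤ m := Nat.cast_nonneg m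
  linarith

/-- `γ(·, χ₄)` is differentiable at `½`. [folklore] -/
private theorem differentiableAt_gammaFactor_χ4_half :
    DifferentiableAt ℂ (DirichletCharacter.gammaFactor (ZMod.χ₄.ringHomComp (Int.castRingHom ℂ) : DirichletCharacter ℂ 4)) (1 / 2) := by
  rw [gammaFactor_χ4_eq]
  have hπ : (π : ℂ) ≠ 0 := by exact_mod_cast Real.pi_ne_zero
  have h34 : ((1 / 2 : ℂ) + 1) / 2 = 3 / 4 := by norm_num
  refine DifferentiableAt.mul ?_ ?_
  · exact DifferentiableAt.const_cpow (by fun_prop) (Or.inl hπ)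
  · have hΓ : DifferentiableAt ℂ Complex.Gamma (((1 / 2 : ℂ) + 1) / 2) := by
      rw [h34]; exact Complex.differentiableAt_Gamma _ three_quarters_ne_neg_nat
    exact hΓ.comp (1 / 2 : ℂ) (by fun_prop)

/-- **The Gamma factor**: `(γ'/γ)(½, χ₄) = −½ log π + ½ ψ(¾)` for the odd Gamma factor
`γ(s, χ₄) = Γ_ℝ(s + 1) = π^{−(s+1)/2} Γ((s+1)/2)`. [cite: Suzuki2025Chebyshev, §4.1 (4.6)] -/
theorem logDeriv_gammaFactor_χ4_half :
    deriv (DirichletCharacter.gammaFactor (ZMod.χ₄.ringHomComp (Int.castRingHom ℂ) : DirichletCharacter ℂ 4)) (1 / 2) /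
      DirichletCharacter.gammaFactor (ZMod.χ₄.ringHomComp (Int.castRingHom ℂ) : DirichletCharacter ℂ 4) (1 / 2) =
      -(Real.log π : ℂ) / 2 + Complex.digamma (3 / 4) / 2 := by
  have hG := gammaFactor_χ4_eq
  have hπ : (π : ℂ) ≠ 0 := by exact_mod_cast Real.pi_ne_zero
  have h34 : ((1 / 2 : ℂ) + 1) / 2 = 3 / 4 := by norm_num
  -- the two factors and their derivatives at `1/2`
  have h1 : HasDerivAt (fun s : ℂ ↦ (π : ℂ) ^ (-(s + 1) / 2))
      ((π : ℂ) ^ (-((1 / 2 : ℂ) + 1) / 2) * Complex.log π * (-1 / 2)) (1 / 2) := by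
    have hin : HasDerivAt (fun s : ℂ ↦ -(s + 1) / 2) (-1 / 2) (1 / 2) := by
      have := (((hasDerivAt_id (1 / 2 : ℂ)).add_const 1).neg).div_const 2
      refine this.congr_deriv ?_; ring
    exact hin.const_cpow (Or.inl hπ)
  have hΓd : DifferentiableAt ℂ Complex.Gamma (3 / 4) :=
    Complex.differentiableAt_Gamma _ three_quarters_ne_neg_nat
  have h2 : HasDerivAt (fun s : ℂ ↦ Complex.Gamma ((s + 1) / 2))
      (deriv Complex.Gamma (3 / 4) * (1 / 2)) (1 / 2) := by
    have hin : HasDerivAt (fun s : ℂ ↦ (s + 1) / 2) (1 / 2) (1 / 2) := by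
      have := ((hasDerivAt_id (1 / 2 : ℂ)).add_const 1).div_const 2
      refine this.congr_deriv ?_; ring
    have hd : HasDerivAt Complex.Gamma (deriv Complex.Gamma (3 / 4)) (((1 / 2 : ℂ) + 1) / 2) := by
      rw [h34]; exact hΓd.hasDerivAt
    exact hd.comp (1 / 2 : ℂ) hin
  have hprod : HasDerivAt (fun s : ℂ ↦ (π : ℂ) ^ (-(s + 1) / 2) * Complex.Gamma ((s + 1) / 2))
      ((π : ℂ) ^ (-((1 / 2 : ℂ) + 1) / 2) * Complex.log π * (-1 / 2) * Complex.Gamma (((1 / 2 : ℂ) + 1) / 2) +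
        (π : ℂ) ^ (-((1 / 2 : ℂ) + 1) / 2) * (deriv Complex.Gamma (3 / 4) * (1 / 2))) (1 / 2) :=
    h1.mul h2
  have hΓ0 : Complex.Gamma (3 / 4) ≠ 0 := Complex.Gamma_ne_zero_of_re_pos (by norm_num)
  have hpow0 : (π : ℂ) ^ (-((1 / 2 : ℂ) + 1) / 2) ≠ 0 := by
    rw [Ne, Complex.cpow_eq_zero_iff, not_and_or]; exact Or.inl hπ
  have hlogπ : Complex.log π = (Real.log π : ℂ) := (Complex.ofReal_log Real.pi_pos.le).symm
  rw [hG, hprod.deriv]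
  beta_reduce
  rw [h34, Complex.digamma, logDeriv_apply, hlogπ]
  field_simp

/-- **(4.6) at `χ = χ₄`**: `(L'/L)(½, χ₄) = −log 2 + ½ log π − ½ ψ(¾)` (`= ½[log(π/4) − (Γ'/Γ)(¾)]`),
from `L = Λ/γ`. [cite: Suzuki2025Chebyshev, §4.1 (4.6)] -/
theorem logDeriv_LFunction_χ4_half :
    logDeriv (DirichletCharacter.LFunction (ZMod.χ₄.ringHomComp (Int.castRingHom ℂ) : DirichletCharacter ℂ 4)) (1 / 2) =
      -(Real.log 2 : ℂ) + (Real.log π : ℂ) / 2 - Complex.digamma (3 / 4) / 2 := by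
  set χ : DirichletCharacter ℂ 4 := ZMod.χ₄.ringHomComp (Int.castRingHom ℂ) with hχdef
  have hχ1 : χ ≠ 1 := χ4_ne_one
  have hfun : χ.LFunction = fun s ↦ χ.completedLFunction s / χ.gammaFactor s := by
    funext s
    exact DirichletCharacter.LFunction_eq_completed_div_gammaFactor χ s (Or.inr (by norm_num))
  have hG : χ.gammaFactor (1 / 2) ≠ 0 :=
    SiegelZero.gammaFactor_ne_zero_of_re_pos χ (by norm_num)
  have hΛhalf : χ.completedLFunction (1 / 2) ≠ 0 := by
    intro h0
    have hL := DirichletCharacter.LFunction_eq_completed_div_gammaFactor χ (1 / 2) (Or.inr (by norm_num))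
    rw [h0, zero_div] at hL
    exact LFunction_χ4_half_ne_zero hL
  have hdΛ : DifferentiableAt ℂ χ.completedLFunction (1 / 2) :=
    (DirichletCharacter.differentiable_completedLFunction hχ1 _)
  have hdG : DifferentiableAt ℂ χ.gammaFactor (1 / 2) := differentiableAt_gammaFactor_χ4_half
  rw [hfun, logDeriv_div (1 / 2 : ℂ) hΛhalf hG hdΛ hdG, logDeriv_apply, logDeriv_apply,
    logDeriv_completedLFunction_χ4_half, logDeriv_gammaFactor_χ4_half]
  ring

/-- **`ψ(¾) ≤ −γ`** (real part), from Andrews–Askey–Roy (1.2.13) in the tree: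
`ψ(w) + γ = Σ_k (1/(k+1) − 1/(w+k))`, whose terms are negative at `w = ¾`.
[cite: AndrewsAskeyRoy1999, Thm 1.2.5 (1.2.13)] -/
theorem re_digamma_three_quarters_le : (Complex.digamma (3 / 4)).re ≤ -Real.eulerMascheroniConstant := by
  have h := Literature.Analysis.SpecialFunctions.Complex.hasSum_one_div_sub_one_div_digamma
    (w := (3 / 4 : ℂ)) (by norm_num)
  have hre := Complex.hasSum_re h
  have hterm : ∀ k : ℕ, (1 / ((k : ℂ) + 1) - 1 / ((3 / 4 : ℂ) + k)).re ≤ 0 := by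
    intro k
    have hk : (0 : ℝ) ≤ k := Nat.cast_nonneg k
    have e1 : (1 / ((k : ℂ) + 1)).re = 1 / ((k : ℝ) + 1) := by
      rw [show (k : ℂ) + 1 = (((k : ℝ) + 1 : ℝ) : ℂ) by push_cast; ring, ← Complex.ofReal_one,
        ← Complex.ofReal_div, Complex.ofReal_re]
    have e2 : (1 / ((3 / 4 : ℂ) + k)).re = 1 / (3 / 4 + (k : ℝ)) := by
      rw [show (3 / 4 : ℂ) + k = ((3 / 4 + (k : ℝ) : ℝ) : ℂ) by push_cast; ring, ← Complex.ofReal_one,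
        ← Complex.ofReal_div, Complex.ofReal_re]
    rw [Complex.sub_re, e1, e2, sub_nonpos]
    exact one_div_le_one_div_of_le (by positivity) (by linarith)
  have hle := hre.nonpos hterm
  rw [Complex.add_re, Complex.ofReal_re] at hle
  linarith

/-- **`(L'/L)(½, χ₄) > 0`** (real part): `−log 2 + ½ log π − ½ ψ(¾) ≥ −log 2 + ½ log π + ½ γ > 0`
(`γ > ½`, `log π > 1`, `log 2 < 0.6931471808`); numerically `(L'/L)(½, χ₄) = 0.4221…` and the sum (4.1)
is eventually NEGATIVE under GRH. (Suzuki: «`Re(L'/L)(1/2)` is a nonzero real number», (4.6).)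
[cite: Suzuki2025Chebyshev, §4.1 (4.6)] -/
theorem re_logDeriv_LFunction_χ4_half_pos :
    0 < (logDeriv (DirichletCharacter.LFunction (ZMod.χ₄.ringHomComp (Int.castRingHom ℂ) : DirichletCharacter ℂ 4)) (1 / 2)).re := by
  rw [logDeriv_LFunction_χ4_half]
  simp only [Complex.sub_re, Complex.add_re, Complex.neg_re, Complex.ofReal_re, Complex.div_ofNat_re]
  have hψ := re_digamma_three_quarters_le
  have hγ := Real.one_half_lt_eulerMascheroniConstant
  have h2 := Real.log_two_lt_d9
  have hπ : 1 < Real.log π := by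
    rw [Real.lt_log_iff_exp_lt Real.pi_pos]
    have := Real.exp_one_lt_d9
    linarith [Real.pi_gt_three]
  nlinarith


/-! ## §3 Theorem 3: (i) ⟹ (iii), (i) ⟹ (ii), (iii) ⟹ (ii) -/

/-- The complex Riesz mean of `χ₄` is the real one, cast. [folklore] -/
private theorem rieszMean_χ4_ofReal (x : ℝ) :
    ∑ n ∈ Finset.Icc 1 ⌊x⌋₊, (Λ n : ℂ) * (ZMod.χ₄.ringHomComp (Int.castRingHom ℂ)) (n : ZMod 4) /
        (Real.sqrt n : ℂ) * ((1 - Real.log n / Real.log x : ℝ) : ℂ) =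
      ((∑ n ∈ Finset.Icc 1 ⌊x⌋₊,
        Λ n * (ZMod.χ₄ (n : ZMod 4) : ℝ) / Real.sqrt n * (1 - Real.log n / Real.log x) : ℝ) : ℂ) := by
  push_cast
  refine Finset.sum_congr rfl fun n _ ↦ ?_
  rw [χ4_apply]

/-- The complex `f_{χ₄}(x)` is the real sum `Σ_{n ≤ x} Λ(n)χ₄(n) n^{-1/2} log(x/n)`, cast. [folklore] -/
private theorem halfLineSum_χ4_ofReal (x : ℝ) :
    HalfLineRiesz.halfLineSum (ZMod.χ₄.ringHomComp (Int.castRingHom ℂ) : DirichletCharacter ℂ 4) x =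
      ((∑ n ∈ Finset.Icc 1 ⌊x⌋₊, Λ n * (ZMod.χ₄ (n : ZMod 4) : ℝ) / Real.sqrt n * Real.log (x / n) : ℝ) : ℂ) := by
  rw [HalfLineRiesz.halfLineSum]
  push_cast
  refine Finset.sum_congr rfl fun n _ ↦ ?_
  rw [show ((n : ℕ) : ZMod 4) = (n : ZMod 4) from rfl, χ4_apply]

/-- `Σ_{n ≤ x} Λ(n)χ₄(n) n^{-1/2} log(x/n) = log x · Σ_{n ≤ x} Λ(n)χ₄(n) n^{-1/2}(1 − log n/log x)` (`x > 1`).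
[cite: Suzuki2025Chebyshev, §4.1 (4.2)–(4.3)] -/
theorem sum_log_eq_log_mul_rieszMean {x : ℝ} (hx : 1 < x) :
    ∑ n ∈ Finset.Icc 1 ⌊x⌋₊, Λ n * (ZMod.χ₄ (n : ZMod 4) : ℝ) / Real.sqrt n * Real.log (x / n) =
      Real.log x * ∑ n ∈ Finset.Icc 1 ⌊x⌋₊,
        Λ n * (ZMod.χ₄ (n : ZMod 4) : ℝ) / Real.sqrt n * (1 - Real.log n / Real.log x) := by
  have hlx : Real.log x ≠ 0 := (Real.log_pos hx).ne'
  rw [Finset.mul_sum]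
  refine Finset.sum_congr rfl fun n hn ↦ ?_
  rw [Finset.mem_Icc] at hn
  have hn0 : (0 : ℝ) < n := by exact_mod_cast hn.1
  rw [Real.log_div (by linarith) hn0.ne']
  field_simp

/-- **Suzuki 2025, Thm 3, (i) ⟹ (iii), PROVED**: the GRH for `L(s, χ₄)` implies
`lim_{x→∞} Σ_{n ≤ x} Λ(n)χ₄(n) n^{-1/2}(1 − log n/log x) = −(L'/L)(½, χ₄)` ((1.15); Thm 8 (4.2) at `χ = χ₄`, from
`HalfLineRiesz.tendsto_rieszMean_of_GRH` with `χ₄` primitive and `L(½, χ₄) ≠ 0`). GRH(χ₄)-CONDITIONAL.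
[cite: Suzuki2025Chebyshev, §1.2 Thm 3 ((i) ⟹ (iii)) with §4.1 Thm 8 ((4.2), (4.5))] -/
theorem Suzuki2025Chebyshev_thm3_i_imp_iii
    (hGRH : DirichletCharacter.RiemannHypothesis (ZMod.χ₄.ringHomComp (Int.castRingHom ℂ) : DirichletCharacter ℂ 4)) :
    Tendsto (fun x : ℝ ↦
        ∑ n ∈ Finset.Icc 1 ⌊x⌋₊, Λ n * (ZMod.χ₄ (n : ZMod 4) : ℝ) / Real.sqrt n * (1 - Real.log n / Real.log x))
      atTop (𝓝 (-(logDeriv (DirichletCharacter.LFunction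
        (ZMod.χ₄.ringHomComp (Int.castRingHom ℂ) : DirichletCharacter ℂ 4)) (1 / 2)).re)) := by
  have h := HalfLineRiesz.tendsto_rieszMean_of_GRH (χ := ZMod.χ₄.ringHomComp (Int.castRingHom ℂ))
    χ4_isPrimitive (by norm_num) LFunction_χ4_half_ne_zero hGRH
  have h2 := (Complex.continuous_re.tendsto _).comp h
  rw [Complex.neg_re] at h2
  refine h2.congr fun x ↦ ?_
  rw [Function.comp_apply, rieszMean_χ4_ofReal, Complex.ofReal_re]

/-- **Suzuki 2025, Thm 3, (i) ⟹ (ii), PROVED**: the GRH for `L(s, χ₄)` implies that there is `x₀ ≥ 2` with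
`Σ_{n ≤ x} Λ(n)χ₄(n) n^{-1/2} log(x/n) ≤ 0` for all `x ≥ x₀` ((1.14)): under GRH
`f_{χ₄}(x) = −(L'/L)(½, χ₄) log x + O(1)` (`HalfLineRiesz.exists_norm_halfLineSum_add_le_of_GRH`) and
`(L'/L)(½, χ₄) > 0` (`re_logDeriv_LFunction_χ4_half_pos`). GRH(χ₄)-CONDITIONAL.
[cite: Suzuki2025Chebyshev, §1.2 Thm 3 ((i) ⟹ (ii)) with §4.1 Thm 8 ((4.5)–(4.6))] -/
theorem Suzuki2025Chebyshev_thm3_i_imp_ii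
    (hGRH : DirichletCharacter.RiemannHypothesis (ZMod.χ₄.ringHomComp (Int.castRingHom ℂ) : DirichletCharacter ℂ 4)) :
    ∃ x₀ : ℝ, 2 ≤ x₀ ∧ ∀ x : ℝ, x₀ ≤ x →
      ∑ n ∈ Finset.Icc 1 ⌊x⌋₊, Λ n * (ZMod.χ₄ (n : ZMod 4) : ℝ) / Real.sqrt n * Real.log (x / n) ≤ 0 := by
  set χ : DirichletCharacter ℂ 4 := ZMod.χ₄.ringHomComp (Int.castRingHom ℂ) with hχdef
  obtain ⟨B, hB⟩ := HalfLineRiesz.exists_norm_halfLineSum_add_le_of_GRH (χ := χ)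
    χ4_isPrimitive (by norm_num) LFunction_χ4_half_ne_zero hGRH
  set d : ℝ := (logDeriv χ.LFunction (1 / 2)).re with hd
  have hd0 : 0 < d := re_logDeriv_LFunction_χ4_half_pos
  have hDre : (deriv χ.LFunction (1 / 2) / χ.LFunction (1 / 2)).re = d := by
    rw [hd, logDeriv_apply]
  refine ⟨max 2 (Real.exp (B / d)), le_max_left _ _, fun x hx ↦ ?_⟩
  have hx2 : 2 ≤ x := le_trans (le_max_left _ _) hx
  have hx1 : 1 < x := by linarith
  have hlog : B / d ≤ Real.log x := by
    rw [Real.le_log_iff_exp_le (by linarith)]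
    exact le_trans (le_max_right _ _) hx
  have hB' := hB x hx1
  -- real part of `f + log x · D` is `R(x) + log x · d ≤ B`
  have hre : (HalfLineRiesz.halfLineSum χ x + (Real.log x : ℂ) * (deriv χ.LFunction (1 / 2) / χ.LFunction (1 / 2))).re
      = ∑ n ∈ Finset.Icc 1 ⌊x⌋₊, Λ n * (ZMod.χ₄ (n : ZMod 4) : ℝ) / Real.sqrt n * Real.log (x / n)
        + Real.log x * d := by
    rw [Complex.add_re, halfLineSum_χ4_ofReal, Complex.ofReal_re, Complex.re_ofReal_mul, hDre]
  have hle : ∑ n ∈ Finset.Icc 1 ⌊x⌋₊, Λ n * (ZMod.χ₄ (n : ZMod 4) : ℝ) / Real.sqrt n * Real.log (x / n)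
      + Real.log x * d ≤ B := by
    rw [← hre]
    exact (Complex.re_le_norm _).trans hB'
  have hBd : B ≤ Real.log x * d := by
    rw [div_le_iff₀ hd0] at hlog
    linarith
  linarith

/-- **Suzuki 2025, Thm 3, (iii) ⟹ (ii), PROVED**: the Riesz limit (1.15) implies (1.14) eventually, because the
limit `−(L'/L)(½, χ₄)` is NEGATIVE (`re_logDeriv_LFunction_χ4_half_pos`; Suzuki: «since `χ₄` is primitive, the
third claim implies the second claim», via (4.6)). RH-FREE implication between two clauses of the criterion.
[cite: Suzuki2025Chebyshev, §1.2 Thm 3 ((iii) ⟹ (ii)), proof at the end of §4.1] -/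
theorem Suzuki2025Chebyshev_thm3_iii_imp_ii
    (h : Tendsto (fun x : ℝ ↦
        ∑ n ∈ Finset.Icc 1 ⌊x⌋₊, Λ n * (ZMod.χ₄ (n : ZMod 4) : ℝ) / Real.sqrt n * (1 - Real.log n / Real.log x))
      atTop (𝓝 (-(logDeriv (DirichletCharacter.LFunction
        (ZMod.χ₄.ringHomComp (Int.castRingHom ℂ) : DirichletCharacter ℂ 4)) (1 / 2)).re))) :
    ∃ x₀ : ℝ, 2 ≤ x₀ ∧ ∀ x : ℝ, x₀ ≤ x →
      ∑ n ∈ Finset.Icc 1 ⌊x⌋₊, Λ n * (ZMod.χ₄ (n : ZMod 4) : ℝ) / Real.sqrt n * Real.log (x / n) ≤ 0 := by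
  have hneg : -(logDeriv (DirichletCharacter.LFunction
      (ZMod.χ₄.ringHomComp (Int.castRingHom ℂ) : DirichletCharacter ℂ 4)) (1 / 2)).re < 0 := by
    linarith [re_logDeriv_LFunction_χ4_half_pos]
  obtain ⟨x₁, hx₁⟩ := eventually_atTop.1 (h.eventually (eventually_lt_nhds hneg))
  refine ⟨max x₁ 2, le_max_right _ _, fun x hx ↦ ?_⟩
  have hx2 : 2 ≤ x := le_trans (le_max_right _ _) hx
  have hx1 : 1 < x := by linarith
  have hlt := hx₁ x (le_trans (le_max_left _ _) hx)
  rw [sum_log_eq_log_mul_rieszMean hx1]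
  exact (mul_neg_of_pos_of_neg (Real.log_pos hx1) hlt).le

end SuzukiChi4Riesz

open SuzukiChi4Riesz in
/-- **Suzuki 2025, Theorem 3 — discharge of the named fact `Suzuki2025Chebyshev_thm3`** (GRH(χ₄)-EQUIVALENT
criterion, AS TYPED in `ChebyshevHalfLineBiasVariants.lean`: `(i) ⟺ (ii)` and `(i) ⟺ (iii)`): assembled from
`Suzuki2025Chebyshev_thm3_i_imp_ii`, `Suzuki2025Chebyshev_thm3_i_imp_iii`, `Suzuki2025Chebyshev_thm3_iii_imp_ii`
(this file) and the tree's `Suzuki2025Chebyshev_thm3_ii_imp_i` (`ChebyshevHalfLineBiasChi4Proofs.lean`, Landau's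
theorem via `Suzuki2025Chebyshev_thm8_sign_holds`). An EQUIVALENCE: it fixes which limit statements ARE the GRH for
`L(s, χ₄)`; it does not move GRH or RH. [cite: Suzuki2025Chebyshev, §1.2 Thm 3 (and §4.1 Thm 8)] -/
theorem Suzuki2025Chebyshev_thm3_holds : Suzuki2025Chebyshev_thm3 := by
  unfold Suzuki2025Chebyshev_thm3
  intro χ
  exact ⟨⟨fun h ↦ Suzuki2025Chebyshev_thm3_i_imp_ii h, fun h ↦ Suzuki2025Chebyshev_thm3_ii_imp_i h⟩,
    ⟨fun h ↦ Suzuki2025Chebyshev_thm3_i_imp_iii h,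
      fun h ↦ Suzuki2025Chebyshev_thm3_ii_imp_i (Suzuki2025Chebyshev_thm3_iii_imp_ii h)⟩⟩

end Literature.NumberTheory.LFunctions

end
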